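import Literature.AnabelianGeometry.EtaleTheta.Discharge.Sec3Prop34iNode
import Literature.AnabelianGeometry.EtaleTheta.TemperedFrobenioidOfTateTowerTheta
import Literature.AnabelianGeometry.EtaleTheta.TemperedFrobenioidOfGaloisCoveringZTower
import HarnessLib

/-!
# [EtTh] Prop. 3.4 (i) — the typed node BINDER-FREE over print's GENUINE base `B^temp(Π^tp_X)⁰` at the two tower models of
# record that live there: the `Ÿ`-skeleton WITH CUSPS (`ThetaTowerTempered.dm`) and the `ℤ`-tower (`ZTowerTempered.dm`)

S. Mochizuki, *The étale theta function …*, Publ. RIMS **45** (2009) [MochizukiEtTh2009], §3, Prop. 3.4 (i), PRIMS PDF p. 74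
l. 27–48; `D₀ := B^temp(X^log)⁰` p. 72 [cite: MochizukiEtTh2009, Prop 3.4 p.74].

PROOF-ONLY sequel of `Sec3Prop34iNode.lean` (abc-iut cell, layer L2, cone node `EtTh:Prop3.4(i)`; seat abc-iut-w6-d058 gen 6;
abc-iut-L2-lead R989; two one-term theorems, 0 defs).  Both abc-iut-L2-t3's `Ÿ`-skeleton with cusps
(`ThetaTowerTempered.dm X φ`, `TemperedFrobenioidOfTateTowerTheta`, p481416) and abc-iut-w5-d179's `ℤ`-tower
(`ZTowerTempered.dm X φ`, `TemperedFrobenioidOfGaloisCoveringZTower`, p463800) ARE abc-iut-w6-d048's small tempered model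
`DivisorMonoids.ofGaloisActionCosetCat X.isTempered …` over `CosetCat Π^tp_X ≌ B^temp(Π^tp_X)⁰` for a GENUINE tempered
arithmetic fundamental group datum `X : TemperedArithmeticGroup K` ([EtTh] §1) and a character `φ : Π^tp_X → ℤ`; so
`DivisorMonoids.prop34_ofGaloisActionCosetCat` (p491362) gives the typed `DivisorMonoids.Prop34` — (i) in the weak reading of
record, and (ii) — at both, with NO hypothesis (the cusp laws are the theorems `TateTowerTheta.cuspLaws` /
`TateTower.cuspLaws`).  HONEST FRAMING: class-(b) models over the genuine base (not the tempered Frobenioid of an actual Tate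
curve); E-14 (printed clause (i)(a) at infinite-component objects) displayed in `Sec3Prop34iNodePrinted.lean`, not
adjudicated; nothing here bears on [IUTchIII] Cor. 3.12; no side taken; typed ≠ proved — here proved.
-/

namespace Literature.AnabelianGeometry.EtaleTheta

open CategoryTheory Opposite Literature.AlgebraicGeometry.Frobenioids Literature.AnabelianGeometry.SemiGraphs

/-- **EtTh:Prop3.4(i) (+ (ii)) at the `Ÿ`-skeleton WITH CUSPS over the genuine base `B^temp(Π^tp_X)⁰` (small model), NO
hypothesis** — for every tempered arithmetic group datum `X` and character `φ : Π^tp_X → ℤ`.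
[cite: MochizukiEtTh2009, Prop 3.4 p.74] -/
theorem ThetaTowerTempered.prop34_node {K : Type} [Field K] (X : TemperedArithmeticGroup.{0} K)
    (φ : X.Pi →* Multiplicative ℤ) (R R' : ((CosetCat X.Pi)ᵒᵖ ⥤ CommMonCat.{0}) → Prop) :
    (ThetaTowerTempered.dm X φ).Prop34 treeMonoidVocabWeak.{0} (treeCatVocab _ R R') :=
  DivisorMonoids.prop34_ofGaloisActionCosetCat X.isTempered (LogDivisorModel.TateTowerTheta.action φ)
    LogDivisorModel.TateTowerTheta.cuspLaws R R'

/-- **EtTh:Prop3.4(i) (+ (ii)) at the `ℤ`-tower over the genuine base `B^temp(Π^tp_X)⁰` (small model), NO hypothesis.**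
[cite: MochizukiEtTh2009, Prop 3.4 p.74] -/
theorem ZTowerTempered.prop34_node {K : Type} [Field K] (X : TemperedArithmeticGroup.{0} K)
    (φ : X.Pi →* Multiplicative ℤ) (R R' : ((CosetCat X.Pi)ᵒᵖ ⥤ CommMonCat.{0}) → Prop) :
    (ZTowerTempered.dm X φ).Prop34 treeMonoidVocabWeak.{0} (treeCatVocab _ R R') :=
  DivisorMonoids.prop34_ofGaloisActionCosetCat X.isTempered (LogDivisorModel.ZTower.action φ)
    LogDivisorModel.TateTower.cuspLaws R R'

end Literature.AnabelianGeometry.EtaleTheta
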